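import Summits.RiemannHypothesis.RiemannHypothesis.Theorems.TiltedLandingLaw421R3SinkCertLink

/-!
# «SinkDatumNeg» HOLD v1 — the (D)-cone residual of 142 is FALSE: `¬ DatumConeRSig lam` for every `0 < lam`
(C4 «kernel desk», rh-idea-6 g44; files-only; NEGATIVE EDGE next to 142 «SinkCertLink»; built on director-rh (CA1059)(2) «(D)-SCAN-1 … if (D) fails on an
open subset for every lam, say so plainly»; HOLD drawer — NOT keyed; it can only elaborate ALONE once 142 lands (its ONE import is 142's target); until
then the evidence is the COMBINED check `SinkDatumNeg-HOLD-v1-COMBINED-…` = 142's keyed bytes cfbfae5a + this body, rc 0, and its PLANT rc 1)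

ONE import: 142 «SinkCertLink» (pending `…R3SinkCertLink`; carries 118 #1276, 119 #1277 over 109 #1261's closed forms, 117 #1269).  Namespace
`RhW08.SinkDatumNeg`; nothing re-declared.

WHAT 142 TYPED.  `DatumConeRSig lam` (142 :108): for every right CONE datum of 117's block some weight `y0 ∈ [0,1]` puts the REAL-direction two-point
family `realTwoPoint xv h y0 w` at `σ*(y0) = cornerSigma …` in the datum alternative (D) at the model read value `−mult·K`, `K = farPairK v w`; by 142 :80
this is the real alternative `‖K‖/lam ≤ Re K − σ*·Im K ∨ 1/(2s) < Re K − σ*·Im K`.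

WHAT THIS FILE PROVES.  `not_datumConeRSig : 0 < lam → ¬ DatumConeRSig lam`.  WITNESS (a legal cone datum of 117's block): `xv = 0, R = 2, s = 1/4,
h = 1/2, v = i/2, w = 15i/32, mult = 1` — the child DIRECTLY BELOW the state.  There `Re K = 0` (`witness_re`), `Im K = 1/(Y−t) − 1/(Y+t) = 960/31`
(`witness_im`), the LEFT top-corner numerator of the family is `(1 − y0)·(f(1/2) − f(15/32)) ≥ 0` with `f(y) = 1/(1+(y−1)²) + 1/(1+(y+1)²)`
(`witness_numer_nonneg`) over a positive `c` (`witness_c_pos`), so `σ*(y0) ≥ 0` for EVERY weight (`witness_sigma_nonneg`), hence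
`L_cert = Re K − σ*·Im K ≤ 0` while both disjuncts of (D) need `L_cert > 0` (`‖K‖/lam > 0`, `1/(2s) = 2`).  Corollary `lam_nonpos_of_datumConeRSig`.
MECHANISM (why, in words): real-direction cuts see only `Re G`, and the model read value of an axis zero pair on the vertical below it is purely
imaginary; (D)-SCAN-1 (floats, `g44/scan/DSCAN1-*`) shows the failure persists on an open set of small-offset cone children for every `lam ≤ 16`.
WHAT IS NOT REFUTED: 117's `CertificatesExistRightSig lam` and its cone half — their cut DIRECTIONS are free (at `δ = 0` the one-cut family
`{p0 = w, e = −K/‖K‖, y = 1}` has `N ≡ 0`, (K) with `σ = 0`, `L_cert = mult·‖K‖`); only the `e = −1` slice at `σ*` dies.  CONSEQUENCE for 142: ★:182/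
:187/:192/:197 keep type-checking but their hypothesis `hD` is unsatisfiable for `0 < lam`.
LEVEL: NEGATIVE EDGE (a theorem `¬ S` about a typed residual).  No `sorry`.  Nothing here bears on the truth of RH; RH is not proved; ⟨33346⟩/⟨33347⟩
OPEN; `CertificatesExistRightSig` / `CertificatesExistSig` / `CornerDominance*RSig` / `CertificatesNonConeRSig` OPEN; checked ≠ keyed ≠ landed ≠ proved.
-/

noncomputable section

namespace RhW08.SinkDatumNeg

open Complex
open scoped ComplexConjugate
open RhW08.SinkTemplate RhW08.SinkBdry RhW08.SinkCertLink

/-- the WITNESS child `w = 15i/32` directly below the state `v = i/2` (`xv = 0`): `Re K = 0`. -/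
theorem witness_re : (farPairK (⟨0, 1 / 2⟩ : ℂ) ⟨0, 15 / 32⟩).re = 0 := by
  rw [farPairK_re _ _ 0]
  simp [pairReForm]

/-- … and `Im K = 1/(Y − t) − 1/(Y + t) = 960/31 > 0`. -/
theorem witness_im : (farPairK (⟨0, 1 / 2⟩ : ℂ) ⟨0, 15 / 32⟩).im = 960 / 31 := by
  have h := farPairC_eq (⟨0, 15 / 32⟩ : ℂ) ⟨0, 1 / 2⟩ 0
  unfold farPairC pairCForm at h
  simp only [sub_zero] at h
  norm_num at h
  linarith

/-- … the LEFT-corner numerator of the real two-point family is `(1 − y0)·(f(1/2) − f(15/32)) ≥ 0` (`f(y) = 1/(1+(y−1)²) + 1/(1+(y+1)²)`). -/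
theorem witness_numer_nonneg {y0 : ℝ} (hy1 : y0 ≤ 1) : 0 ≤ twoPointNForm 0 (15 / 32) (1 / 2) y0 (-1) 1 := by
  unfold twoPointNForm
  norm_num
  nlinarith [hy1]

/-- … the LEFT-corner `c` is positive (cone datum). -/
theorem witness_c_pos : 0 < pairCForm 0 (15 / 32) (-1) 1 := by
  unfold pairCForm
  norm_num

/-- … hence `σ* ≥ 0` for EVERY weight `y0 ≤ 1`. -/
theorem witness_sigma_nonneg {y0 : ℝ} (hy1 : y0 ≤ 1) :
    0 ≤ cornerSigma 0 2 (realTwoPoint 0 (1 / 2) y0 ⟨0, 15 / 32⟩) ⟨0, 15 / 32⟩ := by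
  rw [cornerSigma_realTwoPoint]
  have hre : ((⟨0, 15 / 32⟩ : ℂ).re - 0) = 0 := by simp
  rw [hre]
  show 0 ≤ cornerSigmaForm 2 0 (15 / 32) (1 / 2) y0
  unfold cornerSigmaForm
  rw [show (2 : ℝ) / 2 = 1 by norm_num]
  exact le_max_of_le_right (div_nonneg (witness_numer_nonneg hy1) witness_c_pos.le)

/-- ★ NEGATIVE EDGE: 142's (D)-cone residual `DatumConeRSig lam` is FALSE for every `0 < lam`.  WITNESS: `xv = 0, R = 2, s = 1/4, h = 1/2, v = i/2,
w = 15i/32` (the child DIRECTLY BELOW the state — a legal cone datum), `mult = 1`: the model read value `−K_v(w)` is purely imaginary (`Re K = 0`,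
`Im K = 960/31`), the real-direction cuts see only `Re G`, and `σ*(y0) ≥ 0` for every weight, so `L_cert = Re K − σ*·Im K ≤ 0` while both disjuncts of
(D) need `L_cert > 0`.  (The cone half of 117's `CertificatesExistRightSig` is NOT refuted: its cut DIRECTIONS are free; only the `e = −1` slice dies.) -/
theorem not_datumConeRSig {lam : ℝ} (hlam : 0 < lam) : ¬ DatumConeRSig lam := by
  intro hD
  obtain ⟨y0, -, hy1, hDat⟩ := hD 0 2 (1 / 4) (1 / 2) ⟨0, 1 / 2⟩ ⟨0, 15 / 32⟩ 1 (by norm_num) (by norm_num) (by norm_num) rfl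
    (by norm_num) (by norm_num) (by norm_num) (by norm_num) (by norm_num) (by norm_num) le_rfl (by norm_num)
    (by unfold ConeChild; norm_num)
  have hσ := witness_sigma_nonneg hy1
  have hL : (farPairK (⟨0, 1 / 2⟩ : ℂ) ⟨0, 15 / 32⟩).re
      - cornerSigma 0 2 (realTwoPoint 0 (1 / 2) y0 ⟨0, 15 / 32⟩) ⟨0, 15 / 32⟩ * (farPairK (⟨0, 1 / 2⟩ : ℂ) ⟨0, 15 / 32⟩).im ≤ 0 := by
    rw [witness_re, witness_im]
    nlinarith [hσ]
  have hK0 : farPairK (⟨0, 1 / 2⟩ : ℂ) ⟨0, 15 / 32⟩ ≠ 0 := by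
    intro h0
    have h1 := congrArg Complex.im h0
    rw [witness_im, Complex.zero_im] at h1
    norm_num at h1
  unfold DatumAlt at hDat
  rw [lcert_realTwoPoint_neg_mul, Nat.cast_one, one_mul] at hDat
  rcases hDat with h1 | h2
  · have hpos : 0 < ‖farPairK (⟨0, 1 / 2⟩ : ℂ) ⟨0, 15 / 32⟩‖ / lam := div_pos (norm_pos_iff.2 hK0) hlam
    linarith
  · norm_num at h2
    linarith

/-- … so ★142 :182's (D)-cone hypothesis can only hold for `lam ≤ 0`: the four-part link is VACUOUS on `0 < lam`. -/
theorem lam_nonpos_of_datumConeRSig {lam : ℝ} : DatumConeRSig lam → lam ≤ 0 := by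
  intro hD
  by_contra h
  exact not_datumConeRSig (lt_of_not_ge h) hD

end RhW08.SinkDatumNeg

end
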